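import Mathlib
import Summits.SmoothPoincare4.SmoothPoincare4.Theorems.HyperbolicEnd.Negative.ExpWeightTest

/-!
# `HyperbolicEnd` (stmt-SmoothPoincare4-7825), line `Sketch`, negative side — strip maximum principle

Helper for the negative side of the line (`Theorems/HyperbolicEnd/Negative/`: frozen-`J`
certificate filling fails in complex dimension one). Statement registered on the crux item
(stub helper_frozen_stripMax); it generalises the maximum principle used by the neck
non-fillability helper (`Negative/NeckNotFillable.lean`).

**Claim.** Let `Λ` be a `C²`, positive, `2πi`-periodic density on the half plane `re w < L`
which is certified with a constant `c' > 0` (`2c'Λ³ ≤ ΛΔΛ - |∇Λ|²`), and put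
`Q(z) = Λ(z) e^{-re z}`. If `s₀ < re p < s₁ < L` and `Q < Q(p)` on both lines `re z = s₀` and
`re z = s₁`, we get a contradiction.

**Proof (elementary maximum principle).** The closed strip `s₀ ≤ re z ≤ s₁` is covered by the
`2πi`-translates of the compact rectangle `[s₀, s₁] ×ℂ [0, 2π]`, so by periodicity the continuous
function `Q` attains its maximum over the whole closed strip at a point `w` of the rectangle
(`strip_le_of_rect_le`). Since `Q(p) ≤ Q(w)` and `Q < Q(p)` on the two boundary lines, `w` lies in
the open strip, hence is a local maximum of `Q` in `ℂ` — excluded by the exponential-weight test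
(`helper_expWeightTest` with `β = 1`, file `Negative/ExpWeightTest.lean`: for a certified
positive `λ`, `λ e^{-β re}` has no local maximum).
-/

noncomputable section

-- the prescribed namespace `Summit.<P>.<Sub>.…` duplicates `SmoothPoincare4` (P = Sub)
set_option linter.dupNamespace false

open scoped ContDiff Topology Real
open Laplacian Set Filter Metric Complex

namespace Summit.SmoothPoincare4.SmoothPoincare4.Theorems.HyperbolicEnd.Negative

/-! ### Periodic reduction to a compact rectangle -/

/-- A bound for a `2πi`-periodic function on the rectangle `[a, b] ×ℂ [0, 2π]` holds on the whole
closed strip `a ≤ re z ≤ b` (copied from `NeckNotFillable.lean`). -/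
private theorem strip_le_of_rect_le {Q : ℂ → ℝ} (hQ : Function.Periodic Q (2 * π * I))
    {a b M : ℝ} (hK : ∀ z ∈ Icc a b ×ℂ Icc 0 (2 * π), Q z ≤ M) {z : ℂ} (ha : a ≤ z.re)
    (hb : z.re ≤ b) : Q z ≤ M := by
  obtain ⟨k, hk1, hk2⟩ : ∃ k : ℤ, (k : ℝ) * (2 * π) ≤ z.im ∧ z.im < ((k : ℝ) + 1) * (2 * π) := by
    refine ⟨⌊z.im / (2 * π)⌋, ?_, ?_⟩
    · have := Int.floor_le (z.im / (2 * π))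
      rwa [le_div_iff₀ Real.two_pi_pos] at this
    · have := Int.lt_floor_add_one (z.im / (2 * π))
      rwa [div_lt_iff₀ Real.two_pi_pos] at this
  rw [← hQ.sub_int_mul_eq k]
  apply hK
  rw [mem_reProdIm]
  constructor
  · have : (z - (k : ℂ) * (2 * π * I)).re = z.re := by simp
    rw [this]
    exact ⟨ha, hb⟩
  · have : (z - (k : ℂ) * (2 * π * I)).im = z.im - k * (2 * π) := by simp
    rw [this]
    constructor <;> nlinarith

/-! ### The registered statement -/

/-- **Strip maximum principle for certified periodic densities.** Let `Λ` be `C²`, positive and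
`2πi`-periodic on the half plane `re w < L`, certified with `c' > 0`
(`2c'Λ³ ≤ ΛΔΛ - |∇Λ|²`), and let `Q = Λ e^{-re}`. If a point `p` with `s₀ < re p < s₁ < L` has
`Q(p)` strictly above the values of `Q` on both lines `re z = s₀`, `re z = s₁`, contradiction:
the maximum of `Q` over the closed strip (compactness of one period rectangle plus periodicity)
is then attained in the open strip, i.e. at a local maximum in `ℂ`, excluded by the
exponential-weight test. -/
theorem helper_frozen_stripMax : ∀ (Λ : ℂ → ℝ) (c' L s₀ s₁ : ℝ) (p : ℂ), 0 < c' → s₀ < p.re →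
    p.re < s₁ → s₁ < L → ContDiffOn ℝ 2 Λ {w : ℂ | w.re < L} →
    (∀ z : ℂ, z.re < L → 2 * c' * Λ z ^ 3 ≤
      Λ z * (Δ Λ) z - ((fderiv ℝ Λ z 1) ^ 2 + (fderiv ℝ Λ z Complex.I) ^ 2)) →
    (∀ z : ℂ, z.re < L → 0 < Λ z) → Function.Periodic Λ (2 * π * Complex.I) →
    (∀ z : ℂ, z.re = s₀ → Λ z * Real.exp (-z.re) < Λ p * Real.exp (-p.re)) →
    (∀ z : ℂ, z.re = s₁ → Λ z * Real.exp (-z.re) < Λ p * Real.exp (-p.re)) → False := by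
  intro Λ c' L s₀ s₁ p hc' hp₀ hp₁ hL hC2 hineq hpos hper hleft hright
  obtain ⟨Q, hQ⟩ : ∃ Q : ℂ → ℝ, Q = fun z => Λ z * Real.exp (-z.re) := ⟨_, rfl⟩
  have hU : IsOpen {w : ℂ | w.re < L} := isOpen_lt Complex.continuous_re continuous_const
  -- one period of the closed strip
  obtain ⟨K, hK⟩ : ∃ K : Set ℂ, K = Icc s₀ s₁ ×ℂ Icc 0 (2 * π) := ⟨_, rfl⟩
  have hKc : IsCompact K := hK ▸ isCompact_Icc.reProdIm isCompact_Icc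
  have hpK : ((p.re : ℝ) : ℂ) ∈ K := by
    rw [hK, mem_reProdIm, Complex.ofReal_re, Complex.ofReal_im]
    exact ⟨⟨hp₀.le, hp₁.le⟩, le_rfl, Real.two_pi_pos.le⟩
  have hKU : K ⊆ {w : ℂ | w.re < L} := fun z hz => by
    rw [hK, mem_reProdIm] at hz
    exact lt_of_le_of_lt hz.1.2 hL
  have hQper : Function.Periodic Q (2 * π * I) := fun z => by
    have hre : (z + 2 * π * I).re = z.re := by simp
    simp only [hQ]
    rw [hper z, hre]
  have hQcont : ContinuousOn Q K := by
    rw [hQ]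
    exact (hC2.continuousOn.mono hKU).mul (Continuous.continuousOn (by fun_prop))
  -- the maximum over one period, hence over the whole closed strip
  obtain ⟨w, hwK, hwmax⟩ := hKc.exists_isMaxOn ⟨_, hpK⟩ hQcont
  rw [isMaxOn_iff] at hwmax
  have hstrip : ∀ z : ℂ, s₀ ≤ z.re → z.re ≤ s₁ → Q z ≤ Q w := fun z ha hb =>
    strip_le_of_rect_le hQper (fun z hz => hwmax z (hK ▸ hz)) ha hb
  -- in particular at `p`
  have hpw : Q p ≤ Q w := hstrip p hp₀.le hp₁.le
  rw [hK, mem_reProdIm] at hwK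
  obtain ⟨⟨hw1, hw2⟩, -⟩ := hwK
  rcases hw1.eq_or_lt with h1 | h1
  · -- the maximum sits on the line `re = s₀`, where `Q < Q p`
    have : Q w < Q p := by
      rw [hQ]
      exact hleft w h1.symm
    linarith
  rcases hw2.eq_or_lt with h2 | h2
  · -- the maximum sits on the line `re = s₁`, where `Q < Q p`
    have : Q w < Q p := by
      rw [hQ]
      exact hright w h2
    linarith
  -- interior point: a local maximum of `Λ e^{-re}` in `ℂ`, excluded by the weight test
  have hwU : w.re < L := lt_trans h2 hL
  have hV : IsOpen {z : ℂ | s₀ < z.re ∧ z.re < s₁} :=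
    (isOpen_lt continuous_const Complex.continuous_re).inter
      (isOpen_lt Complex.continuous_re continuous_const)
  have hlocal : IsLocalMax Q w :=
    Filter.eventually_of_mem (hV.mem_nhds ⟨h1, h2⟩) fun z hz => hstrip z hz.1.le hz.2.le
  have htest := helper_expWeightTest Λ w 1 c' (hC2.contDiffAt (hU.mem_nhds hwU)) (hpos w hwU) hc'
    (hineq w hwU)
  simp only [one_mul] at htest
  rw [hQ] at hlocal
  exact htest hlocal

end Summit.SmoothPoincare4.SmoothPoincare4.Theorems.HyperbolicEnd.Negative

end
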